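import Summits.CriticalPhenomena.CardyFormulaZ2.Theorems.HalfPlaneMarkDensityLaw.Negative.MarkEvents
import Literature.Probability.RandomPlanarGeometry.CardyFunctionIncBeta

/-!
# `HalfPlaneMarkDensityLaw` (crux stmt-CriticalPhenomena-5661): the constant is `dF(η)/dx`, and the
# crux contains the lower half of half-plane Cardy on bond-`ℤ²` (negative-side support, 2/4)

Support file of the crux disprover (cdisprove seat, 2026-08-16); `sorry`-free, standard axioms.

* §1 THE CONSTANT IS RIGHT: `hasDerivAt_cardy_crossRatio` — for `a < b < c < x`,
  `d/dx F(crossRatio ![a,b,c,x]) = density a b c x` (tree fact `hasDerivAt_cardyFunction_holds`,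
  chain rule, and the `rpow` identity `rpow_key_identity` in six independent positive variables); so the
  crux's RHS is exactly `F'(η)∂ₓη`, no free constant.
* §3 WHY THE CRUX RESISTS: `liminf_crossing_ge_cardy` — the crux implies
  `F(η(a,b,c,x)) ≤ liminf_n P_{1/2}[A_n ↔ [⌊cn⌋,⌊xn⌋]×{0} in ℤ×ℕ]` for all `a < b < c < x`
  (Fatou over the position of the fourth mark, whose pointwise limit the crux pins; the Riemann-sum
  bound `lintegral_stepDensity_le` from the exact identity of `MarkEvents` §2; and the FTC
  `integral_density_eq_cardy : ∫_c^x density = F(η)`).  Real form `eventually_crossing_gt`.  Hence a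
  proof of the crux proves the lower bound of Cardy's formula in the lattice half-plane of `ℤ²` (open),
  and a refutation must break a quantity whose window sums are half-plane crossing probabilities; mass
  bookkeeping cannot refute the constant (`∫_c^∞ density = F((b−a)/(c−a)) < 1`).
-/

noncomputable section

namespace Summit.CriticalPhenomena.CardyFormulaZ2.Theorems.HalfPlaneMarkDensityLaw.Negative

open Literature.Probability.Percolation Literature.Probability.LatticeModels
open Literature.Probability.RandomPlanarGeometry
open MeasureTheory Filter Set
open scoped ENNReal NNReal Topology
open Summit.CriticalPhenomena.CardyFormulaZ2.Theses.CardyBoundaryCoulombGas (HalfPlaneMarkDensityLaw)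

/-- Cardy's function `F` (the `RandomPlanarGeometry` copy; `Percolation.cardyFunction` agrees by `rfl`). -/
local notation "𝔽" => Literature.Probability.RandomPlanarGeometry.cardyFunction


/-! ## §1 The constant: `density a b c x = d/dx F(η(a,b,c,x))` (chain rule + `rpow` algebra)

`η(y) = crossRatio ![a,b,c,y] = (b−a)(y−c)/((c−a)(y−b))`, `1 − η = (c−b)(y−a)/((c−a)(y−b))`,
`η' = (b−a)(c−b)/((c−a)(y−b)²)`, tree fact `F'(η) = (cardyConst/3)(η(1−η))^{−2/3}`
(`hasDerivAt_cardyFunction_holds`, PROVED); the product collapses to the crux's RHS exactly.  So the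
typed constant is right: no free constant, no normalisation slip (the grounder's CONSTANT FLAG and the
route review's paper check, now in Lean). -/

/-- `(t^{1/3})³ = t` for `t ≥ 0`. [folklore] -/
lemma rpow_third_pow_three {t : ℝ} (ht : 0 ≤ t) : (t ^ (1 / 3 : ℝ)) ^ (3 : ℕ) = t := by
  rw [← Real.rpow_natCast, ← Real.rpow_mul ht]; norm_num

/-- `(m³)^{1/3} = m` for `m ≥ 0`. [folklore] -/
lemma pow_three_rpow_third {m : ℝ} (hm : 0 ≤ m) : (m ^ (3 : ℕ)) ^ (1 / 3 : ℝ) = m := by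
  rw [← Real.rpow_natCast, ← Real.rpow_mul hm]; norm_num

/-- `(m³)^{−2/3} = (m²)⁻¹` for `m > 0`. [folklore] -/
lemma pow_three_rpow_neg_two_thirds {m : ℝ} (hm : 0 < m) :
    (m ^ (3 : ℕ)) ^ (-(2 / 3) : ℝ) = (m ^ (2 : ℕ))⁻¹ := by
  rw [← Real.rpow_natCast, ← Real.rpow_mul hm.le,
    show ((3 : ℕ) : ℝ) * (-(2 / 3) : ℝ) = -(2 : ℝ) by norm_num, Real.rpow_neg hm.le, Real.rpow_two]

/-- Every positive real is a cube of a positive real. [folklore] -/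
lemma exists_pos_cube (t : ℝ) (ht : 0 < t) : ∃ m : ℝ, 0 < m ∧ m ^ (3 : ℕ) = t :=
  ⟨t ^ (1 / 3 : ℝ), Real.rpow_pos_of_pos ht _, rpow_third_pow_three ht.le⟩

/-- The `rpow` identity behind the constant, in six INDEPENDENT positive variables
`p = b−a, q = c−b, r = c−a, u = x−a, v = x−b, w = x−c`:
`((pquw)/(rv)²)^{−2/3} · (pq/(rv²)) = (pqr)^{1/3} (uvw)^{−2/3}`. [folklore] -/
lemma rpow_key_identity {p q r u v w : ℝ} (hp : 0 < p) (hq : 0 < q) (hr : 0 < r) (hu : 0 < u)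
    (hv : 0 < v) (hw : 0 < w) :
    (p * q * u * w / (r * v) ^ 2) ^ (-(2 / 3) : ℝ) * (p * q / (r * v ^ 2)) =
      (p * q * r) ^ (1 / 3 : ℝ) * (u * v * w) ^ (-(2 / 3) : ℝ) := by
  obtain ⟨P, hP, rfl⟩ := exists_pos_cube p hp
  obtain ⟨Q, hQ, rfl⟩ := exists_pos_cube q hq
  obtain ⟨R, hR, rfl⟩ := exists_pos_cube r hr
  obtain ⟨U, hU, rfl⟩ := exists_pos_cube u hu
  obtain ⟨V, hV, rfl⟩ := exists_pos_cube v hv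
  obtain ⟨W, hW, rfl⟩ := exists_pos_cube w hw
  have h1 : P ^ 3 * Q ^ 3 * U ^ 3 * W ^ 3 / (R ^ 3 * V ^ 3) ^ 2 = (P * Q * U * W / (R * V) ^ 2) ^ 3 := by
    ring
  have h2 : P ^ 3 * Q ^ 3 * R ^ 3 = (P * Q * R) ^ 3 := by ring
  have h3 : U ^ 3 * V ^ 3 * W ^ 3 = (U * V * W) ^ 3 := by ring
  rw [h1, h2, h3, pow_three_rpow_neg_two_thirds (by positivity), pow_three_rpow_third (by positivity),
    pow_three_rpow_neg_two_thirds (by positivity)]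
  field_simp

/-- The cross-ratio of the crux's four marks in closed form. [folklore] -/
lemma crossRatio_four (a b c y : ℝ) :
    crossRatio ![a, b, c, y] = (a - b) * (c - y) / ((a - c) * (b - y)) := by
  simp [crossRatio]

/-- `η(1−η) = (b−a)(c−b)(x−a)(x−c)/((c−a)(x−b))²` for the crux's marks. [folklore] -/
lemma crossRatio_mul_one_sub {a b c x : ℝ} (hab : a < b) (hbc : b < c) (hcx : c < x) :
    crossRatio ![a, b, c, x] * (1 - crossRatio ![a, b, c, x]) =
      (b - a) * (c - b) * (x - a) * (x - c) / ((c - a) * (x - b)) ^ 2 := by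
  rw [crossRatio_four]
  have h1 : a - c ≠ 0 := (by linarith : a - c < 0).ne
  have h2 : b - x ≠ 0 := (by linarith : b - x < 0).ne
  have h3 : c - a ≠ 0 := (by linarith : 0 < c - a).ne'
  have h4 : x - b ≠ 0 := (by linarith : 0 < x - b).ne'
  field_simp
  ring

/-- For `a < b < c < x` the cross-ratio lies in `(0,1)`. [folklore] -/
lemma crossRatio_four_mem_Ioo {a b c x : ℝ} (hab : a < b) (hbc : b < c) (hcx : c < x) :
    crossRatio ![a, b, c, x] ∈ Ioo (0 : ℝ) 1 := by
  refine crossRatio_mem_Ioo (Or.inl ?_)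
  refine Fin.strictMono_iff_lt_succ.2 fun i ↦ ?_
  fin_cases i <;> simp [hab, hbc, hcx]

/-- The derivative of `y ↦ η(a,b,c,y)` at `x`. [folklore] -/
lemma hasDerivAt_crossRatio_four {a b c x : ℝ} (hab : a < b) (hbc : b < c) (hcx : c < x) :
    HasDerivAt (fun y : ℝ ↦ crossRatio ![a, b, c, y]) ((b - a) * (c - b) / ((c - a) * (x - b) ^ 2)) x := by
  have hfun : (fun y : ℝ ↦ crossRatio ![a, b, c, y]) = fun y ↦ (a - b) * (c - y) / ((a - c) * (b - y)) := by
    funext y; exact crossRatio_four a b c y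
  rw [hfun]
  have hN : HasDerivAt (fun y : ℝ ↦ (a - b) * (c - y)) ((a - b) * (-1)) x :=
    ((hasDerivAt_id x).const_sub c).const_mul (a - b)
  have hD : HasDerivAt (fun y : ℝ ↦ (a - c) * (b - y)) ((a - c) * (-1)) x :=
    ((hasDerivAt_id x).const_sub b).const_mul (a - c)
  have h1 : a - c ≠ 0 := (by linarith : a - c < 0).ne
  have h2 : b - x ≠ 0 := (by linarith : b - x < 0).ne
  have h3 : c - a ≠ 0 := (by linarith : 0 < c - a).ne'
  have h4 : x - b ≠ 0 := (by linarith : 0 < x - b).ne'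
  have hDx : (a - c) * (b - x) ≠ 0 := mul_ne_zero h1 h2
  refine (hN.div hD hDx).congr_deriv ?_
  field_simp
  ring

/-- **The constant is right**: `(cardyConst/3)(η(1−η))^{−2/3} · η'(x) = density a b c x`. [folklore] -/
theorem cardyDeriv_mul_eq_density {a b c x : ℝ} (hab : a < b) (hbc : b < c) (hcx : c < x) :
    cardyConst / 3 * (crossRatio ![a, b, c, x] * (1 - crossRatio ![a, b, c, x])) ^ (-(2 / 3) : ℝ) *
        ((b - a) * (c - b) / ((c - a) * (x - b) ^ 2)) = density a b c x := by
  rw [crossRatio_mul_one_sub hab hbc hcx, density]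
  have key := rpow_key_identity (p := b - a) (q := c - b) (r := c - a) (u := x - a) (v := x - b)
    (w := x - c) (by linarith) (by linarith) (by linarith) (by linarith) (by linarith) (by linarith)
  linear_combination (cardyConst / 3) * key

/-- **§1 main**: `d/dx F(η(a,b,c,x)) = density a b c x` on `x > c` — the crux's RHS is exactly the
`x`-derivative of the half-plane Cardy crossing probability `F(η)` between `[a,b]` and `[c,x]`
(Cardy 1992 eq. (8) for `F'`; chain rule). [cite: CardyJPhysA1992, eq. (8)] -/
theorem hasDerivAt_cardy_crossRatio {a b c x : ℝ} (hab : a < b) (hbc : b < c) (hcx : c < x) :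
    HasDerivAt (fun y : ℝ ↦ 𝔽 (crossRatio ![a, b, c, y])) (density a b c x) x := by
  have hη := hasDerivAt_crossRatio_four hab hbc hcx
  have hF : HasDerivAt 𝔽
      (cardyConst / 3 * (crossRatio ![a, b, c, x] * (1 - crossRatio ![a, b, c, x])) ^ (-(2 / 3) : ℝ))
      (crossRatio ![a, b, c, x]) :=
    hasDerivAt_cardyFunction_holds (crossRatio_four_mem_Ioo hab hbc hcx)
  have h := hF.comp x hη
  rw [← cardyDeriv_mul_eq_density hab hbc hcx]
  exact h

/-- The density is positive on `x > c`. [folklore] -/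
lemma density_pos {a b c x : ℝ} (hab : a < b) (hbc : b < c) (hcx : c < x) : 0 < density a b c x := by
  unfold density
  have h1 := cardyConst_pos
  have h2 : 0 < (b - a) * (c - b) * (c - a) := by
    apply mul_pos (mul_pos _ _) <;> linarith
  have h3 : 0 < (x - a) * (x - b) * (x - c) := by
    apply mul_pos (mul_pos _ _) <;> linarith
  have := Real.rpow_pos_of_pos h2 (1 / 3 : ℝ)
  have := Real.rpow_pos_of_pos h3 (-(2 / 3) : ℝ)
  positivity


/-! ## §3 Why it resists: the crux contains the lower half of half-plane Cardy on bond-`ℤ²`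

Fatou over the position `y ∈ (c,x)` of the fourth mark (the crux at `(a,b,c,y)` is exactly the
pointwise limit of the step function `y ↦ n·P[E_n(a,b,c,y)]`), the exact Riemann-sum identity of §2
and the fundamental theorem of calculus with §1 give
`liminf_n P_{1/2}[A_n ↔ [⌊cn⌋,⌊xn⌋] × {0} in ℤ×ℕ] ≥ F(η(a,b,c,x))` (`liminf_crossing_ge_cardy`):
ANY proof of the crux proves the lower bound of Cardy's formula in the lattice half-plane for every
pair of boundary arcs `[a,b]`, `[c,x]` — open for bond-`ℤ²` since 1992 — and any refutation must exhibit
non-convergence, or a non-Cardy limit, of a critical `ℤ²` boundary quantity whose window sums ARE the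
half-plane crossing probabilities.  (The upper bound does not follow from the crux alone: the law of the
`c`-most point carries total mass `F((b−a)/(c−a)) < 1` on `(c,∞)`, the rest sitting on `{A_n ↮ [c,∞)}`,
which the crux does not constrain; the matching `limsup` needs the dual/left-side law.) -/

/-- The lattice density as a step function of the position `y` of the fourth mark. [folklore] -/
def stepDensity (a b c : ℝ) (n : ℕ) (y : ℝ) : ℝ≥0∞ := (n : ℝ≥0∞) * μ (markEvent a b c y n)

/-- The step function factors through `y ↦ ⌊yn⌋`. [folklore] -/
lemma stepDensity_eq_comp (a b c : ℝ) (n : ℕ) :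
    stepDensity a b c n =
      (fun k : ℤ ↦ (n : ℝ≥0∞) * μ (firstHit halfPlane (arcA a b n) ⌊c * n⌋ k)) ∘ fun y : ℝ ↦ ⌊y * n⌋ :=
  rfl

/-- The step function is Borel measurable (it factors through `y ↦ ⌊yn⌋ ∈ ℤ`). [folklore] -/
lemma measurable_stepDensity (a b c : ℝ) (n : ℕ) : Measurable (stepDensity a b c n) := by
  rw [stepDensity_eq_comp]
  exact (measurable_of_countable _).comp (Int.measurable_floor.comp (measurable_id.mul_const _))

/-- The cell of reals whose `n`-th lattice point is `k`: `{y | ⌊yn⌋ = k} = [k/n, (k+1)/n)`. [folklore] -/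
lemma setOf_floor_mul_eq {n : ℕ} (hn : 0 < n) (k : ℤ) :
    {y : ℝ | ⌊y * n⌋ = k} = Ico ((k : ℝ) / n) (((k : ℝ) + 1) / n) := by
  have hn' : (0 : ℝ) < n := by exact_mod_cast hn
  ext y
  simp only [mem_setOf_eq, Int.floor_eq_iff, mem_Ico]
  rw [div_le_iff₀ hn', lt_div_iff₀ hn']

/-- Each cell has length `1/n`. [folklore] -/
lemma volume_setOf_floor_mul_eq {n : ℕ} (hn : 0 < n) (k : ℤ) :
    volume {y : ℝ | ⌊y * n⌋ = k} = ENNReal.ofReal (1 / n) := by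
  rw [setOf_floor_mul_eq hn, Real.volume_Ico]
  congr 1
  have hn' : (n : ℝ) ≠ 0 := by exact_mod_cast hn.ne'
  field_simp
  ring

/-- Cells are measurable. [folklore] -/
lemma measurableSet_setOf_floor_mul_eq (n : ℕ) (k : ℤ) : MeasurableSet {y : ℝ | ⌊y * n⌋ = k} :=
  (Int.measurable_floor.comp (measurable_id.mul_const _)) (measurableSet_singleton k)

/-- `(n : ℝ≥0∞) · ofReal (1/n) = 1` for `n ≥ 1`. [folklore] -/
lemma natCast_mul_ofReal_one_div {n : ℕ} (hn : 0 < n) : (n : ℝ≥0∞) * ENNReal.ofReal (1 / n) = 1 := by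
  have hn' : (0 : ℝ) < n := by exact_mod_cast hn
  rw [one_div, ENNReal.ofReal_inv_of_pos hn', ENNReal.ofReal_natCast]
  exact ENNReal.mul_inv_cancel (by exact_mod_cast hn.ne') (ENNReal.natCast_ne_top n)

/-- **Riemann-sum bound**: `∫_{(c,x)} n·P[E_n(a,b,c,y)] dy ≤ P[A_n ↔ [⌊cn⌋,⌊xn⌋] × {0}]` (`n ≥ 1`):
the step function is constant `n·P[E(k)]` on each cell `{⌊yn⌋ = k}` of length `1/n`, the cells met by
`(c,x)` have `⌊cn⌋ ≤ k ≤ ⌊xn⌋`, and §2 sums the cell masses to the crossing probability. [folklore] -/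
theorem lintegral_stepDensity_le (a b c x : ℝ) {n : ℕ} (hn : 0 < n) (hcx : c ≤ x) :
    ∫⁻ y in Ioo c x, stepDensity a b c n y ≤
      μ (openCrossing halfPlane (arcA a b n) (rowIcc ⌊c * n⌋ ⌊x * n⌋)) := by
  set k₀ : ℤ := ⌊c * n⌋ with hk₀
  set M : ℕ := (⌊x * n⌋ - ⌊c * n⌋).toNat with hM
  set E : ℕ → Set (BondConfig (Site 2)) := fun i ↦ firstHit halfPlane (arcA a b n) k₀ (k₀ + i) with hE
  set cell : ℕ → Set ℝ := fun i ↦ {y : ℝ | ⌊y * n⌋ = k₀ + i} with hcell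
  set g : ℝ → ℝ≥0∞ := fun y ↦ ∑ i ∈ Finset.range (M + 1), (cell i).indicator (fun _ ↦ (n : ℝ≥0∞) * μ (E i)) y
    with hg
  have hmeas_g : Measurable g := by
    refine Finset.measurable_sum _ fun i _ ↦ ?_
    exact measurable_const.indicator (measurableSet_setOf_floor_mul_eq n _)
  have hn0 : (0 : ℝ) ≤ n := Nat.cast_nonneg n
  -- pointwise domination on (c,x)
  have hdom : ∀ y ∈ Ioo c x, stepDensity a b c n y ≤ g y := by
    intro y hy
    have h1 : k₀ ≤ ⌊y * n⌋ := Int.floor_le_floor (mul_le_mul_of_nonneg_right hy.1.le hn0)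
    have h2 : ⌊y * n⌋ ≤ ⌊x * n⌋ := Int.floor_le_floor (mul_le_mul_of_nonneg_right hy.2.le hn0)
    set i : ℕ := (⌊y * n⌋ - k₀).toNat with hi
    have hik : k₀ + (i : ℤ) = ⌊y * n⌋ := by rw [hi, Int.toNat_of_nonneg (by omega)]; ring
    have himem : i ∈ Finset.range (M + 1) := by
      rw [Finset.mem_range, hi, hM]; omega
    have hyc : y ∈ cell i := by simp [hcell, hik]
    calc stepDensity a b c n y = (cell i).indicator (fun _ ↦ (n : ℝ≥0∞) * μ (E i)) y := by
          rw [indicator_of_mem hyc, stepDensity, markEvent_eq_firstHit, hE]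
          simp only [hik]
          rfl
      _ ≤ g y := Finset.single_le_sum (f := fun j ↦ (cell j).indicator (fun _ ↦ (n : ℝ≥0∞) * μ (E j)) y)
          (fun j _ ↦ bot_le) himem
  calc ∫⁻ y in Ioo c x, stepDensity a b c n y ≤ ∫⁻ y in Ioo c x, g y := setLIntegral_mono hmeas_g hdom
    _ ≤ ∫⁻ y, g y := setLIntegral_le_lintegral _ _
    _ = ∑ i ∈ Finset.range (M + 1), ∫⁻ y, (cell i).indicator (fun _ ↦ (n : ℝ≥0∞) * μ (E i)) y := by
          rw [hg, lintegral_finsetSum]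
          exact fun i _ ↦ measurable_const.indicator (measurableSet_setOf_floor_mul_eq n _)
    _ = ∑ i ∈ Finset.range (M + 1), μ (E i) := by
          refine Finset.sum_congr rfl fun i _ ↦ ?_
          rw [lintegral_indicator_const (measurableSet_setOf_floor_mul_eq n _),
            volume_setOf_floor_mul_eq hn, mul_comm (n : ℝ≥0∞) (μ (E i)), mul_assoc,
            natCast_mul_ofReal_one_div hn, mul_one]
    _ = μ (openCrossing halfPlane (arcA a b n) (rowIcc ⌊c * n⌋ ⌊x * n⌋)) := by
          rw [measure_crossing_eq_sum_markEvents a b c x n hcx]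


/-- The crux at `(a,b,c,y)` pins the pointwise limit of the step function at `y`. [folklore] -/
lemma tendsto_stepDensity_of_lawAt {a b c y : ℝ}
    (h : Tendsto (lawSeq a b c y) atTop (𝓝 (density a b c y))) :
    Tendsto (fun n ↦ stepDensity a b c n y) atTop (𝓝 (ENNReal.ofReal (density a b c y))) := by
  have : (fun n : ℕ ↦ stepDensity a b c n y) =
      fun n : ℕ ↦ ENNReal.ofReal ((n : ℝ) * μ.real (markEvent a b c y n)) := by
    funext n
    rw [ENNReal.ofReal_mul (Nat.cast_nonneg n), ENNReal.ofReal_natCast, measureReal_def,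
      ENNReal.ofReal_toReal (measure_ne_top μ _)]
    rfl
  rw [this]
  exact ENNReal.tendsto_ofReal h

/-- `η(a,b,c,y) ∈ [0,1]` for `y ≥ c` (indeed `< 1`). [folklore] -/
lemma crossRatio_four_mem_Icc {a b c y : ℝ} (hab : a < b) (hbc : b < c) (hcy : c ≤ y) :
    crossRatio ![a, b, c, y] ∈ Icc (0 : ℝ) 1 := by
  rw [crossRatio_four]
  have hd : 0 < (a - c) * (b - y) := mul_pos_of_neg_of_neg (by linarith) (by linarith)
  refine ⟨div_nonneg (mul_nonneg_of_nonpos_of_nonpos (by linarith) (by linarith)) hd.le, ?_⟩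
  rw [div_le_one hd]
  nlinarith [mul_nonneg (sub_nonneg.2 hbc.le) (sub_nonneg.2 (by linarith : a ≤ y))]

/-- `y ↦ F(η(a,b,c,y))` is continuous on `[c, x]` (`F` continuous on `[0,1]`, tree fact
`continuousOn_cardyFunction_holds`, PROVED). [folklore] -/
lemma continuousOn_cardy_crossRatio {a b c x : ℝ} (hab : a < b) (hbc : b < c) :
    ContinuousOn (fun y : ℝ ↦ 𝔽 (crossRatio ![a, b, c, y])) (Icc c x) := by
  have hF : ContinuousOn 𝔽 (Icc 0 1) :=
    Literature.Probability.RandomPlanarGeometry.continuousOn_cardyFunction_holds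
  refine hF.comp ?_ fun y hy ↦ crossRatio_four_mem_Icc hab hbc hy.1
  have : (fun y : ℝ ↦ crossRatio ![a, b, c, y]) = fun y ↦ (a - b) * (c - y) / ((a - c) * (b - y)) := by
    funext y; exact crossRatio_four a b c y
  rw [this]
  refine ContinuousOn.div (by fun_prop) (by fun_prop) fun y hy ↦ ?_
  exact (mul_pos_of_neg_of_neg (by linarith) (by linarith [hy.1])).ne'

/-- The claimed density is integrable on `(c, x]` (derivative of a monotone continuous function). [folklore] -/
lemma integrableOn_density {a b c x : ℝ} (hab : a < b) (hbc : b < c) :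
    IntegrableOn (fun y ↦ density a b c y) (Ioc c x) :=
  intervalIntegral.integrableOn_deriv_of_nonneg (continuousOn_cardy_crossRatio hab hbc)
    (fun _ hy ↦ hasDerivAt_cardy_crossRatio hab hbc hy.1) fun _ hy ↦ (density_pos hab hbc hy.1).le

/-- **FTC**: `∫_c^x density a b c y dy = F(η(a,b,c,x))` — the claimed density integrates to the
half-plane Cardy crossing probability between `[a,b]` and `[c,x]` (this is the content of the route's
support item `PureProductIntegrates`, here in integral form). [cite: CardyJPhysA1992, eq. (8)] -/
theorem integral_density_eq_cardy {a b c x : ℝ} (hab : a < b) (hbc : b < c) (hcx : c < x) :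
    ∫ y in c..x, density a b c y = 𝔽 (crossRatio ![a, b, c, x]) := by
  have hcont := continuousOn_cardy_crossRatio (x := x) hab hbc
  have hderiv : ∀ y ∈ Ioo c x,
      HasDerivAt (fun y : ℝ ↦ 𝔽 (crossRatio ![a, b, c, y])) (density a b c y) y :=
    fun y hy ↦ hasDerivAt_cardy_crossRatio hab hbc hy.1
  have hint : IntervalIntegrable (fun y ↦ density a b c y) volume c x := by
    rw [intervalIntegrable_iff_integrableOn_Ioc_of_le hcx.le]
    exact integrableOn_density hab hbc
  rw [intervalIntegral.integral_eq_sub_of_hasDerivAt_of_le hcx.le hcont hderiv hint]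
  have h0 : crossRatio ![a, b, c, c] = 0 := by rw [crossRatio_four]; simp
  simp only [h0, Literature.Probability.RandomPlanarGeometry.cardyFunction_zero, sub_zero]

/-- **§3 main (why the crux resists)**: the crux implies the `liminf` half of Cardy's formula for
bond-`ℤ²` in the lattice half-plane, for every pair of boundary arcs `[a,b]`, `[c,x]`:
`F(η(a,b,c,x)) ≤ liminf_n P_{1/2}[A_n ↔ [⌊cn⌋,⌊xn⌋] × {0} in ℤ×ℕ]`
(Fatou in the position of the fourth mark + §2 + §1/FTC).  So a proof of the crux is at least a proof
of half of half-plane Cardy on `ℤ²` (open), and a disproof must break a statement whose Cesàro means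
are pinned by Cardy. [folklore] -/
theorem liminf_crossing_ge_cardy (hlaw : HalfPlaneMarkDensityLaw) {a b c x : ℝ} (hab : a < b)
    (hbc : b < c) (hcx : c < x) :
    ENNReal.ofReal (𝔽 (crossRatio ![a, b, c, x])) ≤
      liminf (fun n : ℕ ↦ μ (openCrossing halfPlane (arcA a b n) (rowIcc ⌊c * n⌋ ⌊x * n⌋))) atTop := by
  rw [halfPlaneMarkDensityLaw_iff] at hlaw
  have hlim : ∀ y ∈ Ioo c x,
      liminf (fun n ↦ stepDensity a b c n y) atTop = ENNReal.ofReal (density a b c y) :=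
    fun y hy ↦ (tendsto_stepDensity_of_lawAt (hlaw a b c y hab hbc hy.1)).liminf_eq
  have hLHS : ENNReal.ofReal (𝔽 (crossRatio ![a, b, c, x])) =
      ∫⁻ y in Ioo c x, ENNReal.ofReal (density a b c y) := by
    rw [← integral_density_eq_cardy hab hbc hcx, intervalIntegral.integral_of_le hcx.le,
      ofReal_integral_eq_lintegral_ofReal (integrableOn_density hab hbc)
        (ae_restrict_of_forall_mem measurableSet_Ioc fun y hy ↦ (density_pos hab hbc hy.1).le),
      setLIntegral_congr Ioo_ae_eq_Ioc]
  rw [hLHS]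
  calc ∫⁻ y in Ioo c x, ENNReal.ofReal (density a b c y)
      = ∫⁻ y in Ioo c x, liminf (fun n ↦ stepDensity a b c n y) atTop :=
        setLIntegral_congr_fun measurableSet_Ioo fun y hy ↦ (hlim y hy).symm
    _ ≤ liminf (fun n ↦ ∫⁻ y in Ioo c x, stepDensity a b c n y) atTop :=
        lintegral_liminf_le' fun n ↦ (measurable_stepDensity a b c n).aemeasurable
    _ ≤ liminf (fun n : ℕ ↦ μ (openCrossing halfPlane (arcA a b n) (rowIcc ⌊c * n⌋ ⌊x * n⌋))) atTop := by
        refine liminf_le_liminf ?_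
        filter_upwards [eventually_gt_atTop 0] with n hn
        exact lintegral_stepDensity_le a b c x hn hcx.le

/-- `F(η) > 0` for `η ∈ (0,1)` (strict monotonicity and `F(0) = 0`, tree facts PROVED). [folklore] -/
lemma cardyFunction_pos_of_mem_Ioo {η : ℝ} (hη : η ∈ Ioo (0 : ℝ) 1) : 0 < 𝔽 η := by
  have h := Literature.Probability.RandomPlanarGeometry.strictMonoOn_cardyFunction_holds
    (left_mem_Icc.2 zero_le_one) ⟨hη.1.le, hη.2.le⟩ hη.1
  rwa [Literature.Probability.RandomPlanarGeometry.cardyFunction_zero] at h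

/-- Real-valued reading of §3: for every `ε > 0`, eventually
`P_{1/2}[A_n ↔ [⌊cn⌋,⌊xn⌋] × {0} in ℤ×ℕ] > F(η(a,b,c,x)) − ε`. [folklore] -/
theorem eventually_crossing_gt (hlaw : HalfPlaneMarkDensityLaw) {a b c x : ℝ} (hab : a < b)
    (hbc : b < c) (hcx : c < x) {ε : ℝ} (hε : 0 < ε) :
    ∀ᶠ n : ℕ in atTop, 𝔽 (crossRatio ![a, b, c, x]) - ε <
      μ.real (openCrossing halfPlane (arcA a b n) (rowIcc ⌊c * n⌋ ⌊x * n⌋)) := by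
  have hF : 0 < 𝔽 (crossRatio ![a, b, c, x]) :=
    cardyFunction_pos_of_mem_Ioo (crossRatio_four_mem_Ioo hab hbc hcx)
  have h := liminf_crossing_ge_cardy hlaw hab hbc hcx
  have hlt : ENNReal.ofReal (𝔽 (crossRatio ![a, b, c, x]) - ε) <
      liminf (fun n : ℕ ↦ μ (openCrossing halfPlane (arcA a b n) (rowIcc ⌊c * n⌋ ⌊x * n⌋))) atTop :=
    lt_of_lt_of_le ((ENNReal.ofReal_lt_ofReal_iff hF).2 (by linarith)) h
  filter_upwards [eventually_lt_of_lt_liminf hlt] with n hn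
  rw [measureReal_def]
  calc 𝔽 (crossRatio ![a, b, c, x]) - ε ≤ (ENNReal.ofReal (𝔽 (crossRatio ![a, b, c, x]) - ε)).toReal := by
        rw [ENNReal.toReal_ofReal']; exact le_max_left _ _
    _ < (μ (openCrossing halfPlane (arcA a b n) (rowIcc ⌊c * n⌋ ⌊x * n⌋))).toReal :=
        ENNReal.toReal_strict_mono (measure_ne_top μ _) hn

end Summit.CriticalPhenomena.CardyFormulaZ2.Theorems.HalfPlaneMarkDensityLaw.Negative
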